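import Summits.QuantumFields.YangMills.Theorems.AlphaInputsT3ACv3Lane
import Summits.QuantumFields.YangMills.Theorems.AlphaInputsT3ACv3Induction
import Summits.QuantumFields.YangMills.Theorems.AlphaInputsT3ACv3Ready
import HarnessLib

/-!
# `AlphaInputsT3ACv3` — THE (α) SOCKET READ AT THE T³ OBJECTS, VERSION 3 (owner RULING g18-№3 §3, cell ym3-torus, 2026-08-27): `AlphaInputsT3AC.OfV3At F 𝔠 a₀ a₁`,
# the record-parametric closed proposition `AlphaInputsT3ACv3Rec L`, the package's data `PkgAtV3` at `(γ, K)` and the rows projected — lane `pub-balaban3d`,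
# seat alpha-1 (g3)

WHAT v3 IS.  `OfV2At`'s quantifier shell VERBATIM over the NEW lane package `AlphaV3AC.RunAlphaV3AC` (`AlphaInputsT3ACv3Lane`): print's (α) step rows with the one
mass-carrying (β) residual `fibre49` (the (49) ≤ (55)·(58) display for the lane's FLOORED masses) REPLACED by the pinned, windowed residual `PinnedStep.Fibre55WinAC` —
PINNED masses `massRecP` (`M(triv) ≡ 1`: no transported trivial mass, no `T_k 1` factor anywhere), print's `χ_{k+1}` window INSIDE the row, instantiated with the (40)
window of the datum's `Adm = ChargedT3` (`AlphaInputsT3AC.admWindowT3`).  The Jacobian of `blockAvg ℰp` lives in the pieces (`logZU`, `Pold`, `logFl → Pint_{k+1}`,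
`E^{(k)}`); the Haar compatibility E6′ is assumed NOWHERE.  A NEW package, not «`OfV2At ∧ rows`» (finding P-g18-1).  `OfV3At`/`AlphaInputsT3ACv3Rec` are OPEN
hypothesis schemas, never asserted; everything else here is proved.

CONTENTS: §1 `OfV3At`, `AlphaInputsT3ACv3Rec L` (v2Rec's text twin); §2 `PkgAtV3` (the ∃-clause at `(γ, K)` as a record carrying the given constants),
`OfV3At.pkgAtV3` (choice through a subtype: `pkgAtV3_a₀/a₁`); §3 the record's API (tower abbreviations, (47) pointwise and the (41)_{k+1} exponent step from the rows, the
`Fibre55WinAC` rows BY PROJECTION, `ρ_j = towerDensity` / `resDensity = e^{E}ρ_j` a.e., (47)′ normal form, `mainT = β_K·A₄∘U`, `E_j − E`, `Rm` closed form,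
`ε₁(j) = θBal(K − j)`, data rows at every `k ≤ K`, minimiser rows r1–r3); §4 **(41) WITH THE WINDOWED PINNED WEIGHTS, `dV`-a.e., every `j ≤ K`, FROM THE v3 ROWS
ALONE** (`PkgAtV3.ineq41P_ae`) and its (41)′ normal form.  L-floor: `Odd L ∧ 1 < L` (the family's) throughout.

References: T. Bałaban, Commun. Math. Phys. 102 (1985) 255–275 [Balaban1985UV3]; Commun. Math. Phys. 102 (1985) 277–309 [Balaban1985Variational].
-/

set_option autoImplicit false

noncomputable section

namespace Summit.QuantumFields.YangMills.Theorems

open MeasureTheory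
open scoped BigOperators
open Literature.MathematicalPhysics.QuantumFieldTheory.Balaban1983to89
open Literature.MathematicalPhysics.QuantumFieldTheory.Balaban1983to89.B10 (Ineq47)
open Literature.MathematicalPhysics.QuantumFieldTheory.Balaban1983to89.T3ContinuumYM3Torus
open Literature.MathematicalPhysics.QuantumFieldTheory.Balaban1983to89.T3UnitLawDensityEML (ℰp)
open Literature.MathematicalPhysics.QuantumFieldTheory.Balaban1983to89.T3UnitScaleTilt (θBal)
open Literature.MathematicalPhysics.QuantumFieldTheory.Balaban1983to89.T3LevelShift (fieldShift)
open Literature.MathematicalPhysics.QuantumFieldTheory.Balaban1983to89.T3PrintedRegularMinimiser (regFibrePr minActionRegPr)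
open Literature.MathematicalPhysics.QuantumFieldTheory.Balaban1983to89.T3PrintedMinimiserExistence (regFibrePr_mono minActionRegPr_eq_of_isMinOn)
open Literature.MathematicalPhysics.QuantumFieldTheory.Balaban1983to89.T3RestrictedUnitDensity (towerDensity resDensity)
open Literature.MathematicalPhysics.QuantumFieldTheory.Balaban1983to89.Missing (boltzmann)
open Literature.MathematicalPhysics.QuantumFieldTheory.Balaban1983to89.B10Eq38TorusDomains (plaqsIn)
open Literature.MathematicalPhysics.QuantumFieldTheory.Balaban1983to89.B10Eq42TorusConstraint (bondsIn lam42)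
open Literature.MathematicalPhysics.QuantumFieldTheory.Balaban1985CMP102
open Literature.MathematicalPhysics.QuantumFieldTheory.Balaban1985CMP102.Setting
open Summit.QuantumFields.Balaban3D.Carriers
open Summit.QuantumFields.Balaban3D.Proofs.Primitives
open Summit.QuantumFields.Balaban3D.Proofs.Inputs (rcoefOf_carrier)
open Summit.QuantumFields.Balaban3D.Proofs.GroupModelLieC (lieC)
open Summit.QuantumFields.Balaban3D.Proofs.TowerAC
open Summit.QuantumFields.Balaban3D.Proofs.StandardAC
open Summit.QuantumFields.Balaban3D.Proofs.InputsAC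
open Summit.QuantumFields.Balaban3D.Proofs.AlphaAC (AlphaDataAC)
open Summit.QuantumFields.YangMills.Theorems.AlphaV3AC

/-! ## §1 The v3 package at given constants and the record-parametric closed proposition -/

/-- **(α) AT THE T³ OBJECTS, VERSION 3, AT GIVEN [7] CONSTANTS `a₀, a₁`** (hypothesis schema, OPEN, never asserted): for every coupling `γ ∈ (0, (min γ₀ 1)²]` and every `K`,
minimizer data, expansion data and auxiliary data with (i) the v3 (α) rows `AlphaV3AC.RunAlphaV3AC` for the pinned inputs `XT3` and the (40) windows `admWindowT3` of the
datum's `Adm` — the (α) step rows of print with the (β) residual at every new history read as (55) p.269 with (58) p.270 over PINNED masses with print's `χ_{k+1}` window,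
no transported trivial mass —, (ii) the minimiser rows `MinimiserRowsT3 … a₀ a₁ K UkH`, (iii) the terminal rows.  `OfV2At`'s text with `RunAlphaAC ↦ RunAlphaV3AC … admWindowT3`.
[cite: Balaban1985UV3, Thm 2 p.272 + (40)–(41) p.266 + (55) p.269; Balaban1985Variational, Thm 1 (8) p.279] -/
def AlphaInputsT3AC.OfV3At (F : T3Family) (𝔠 : AlphaConsts F.L (suGroupModel 2).N) (a₀ a₁ : ℝ) : Prop :=
  ∀ (γ : ℝ) (hγ : 0 < γ) (hγ1 : γ ≤ (min 𝔠.gamma0 1) ^ 2) (K : ℕ),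
    ∃ (reg : ℕ → Set (GaugeField (F.P K) 0 (Matrix.specialUnitaryGroup (Fin 2) ℂ)))
      (Uk : (k : ℕ) → GaugeField (F.P K) (k + 1) (Matrix.specialUnitaryGroup (Fin 2) ℂ) →
        GaugeField (F.P K) 0 (Matrix.specialUnitaryGroup (Fin 2) ℂ))
      (UkH : (k : ℕ) → Hist (F.P K) k → GaugeField (F.P K) k (Matrix.specialUnitaryGroup (Fin 2) ℂ) →
        GaugeField (F.P K) 0 (Matrix.specialUnitaryGroup (Fin 2) ℂ))
      (hU0 : ∀ V : GaugeField (F.P K) 0 (Matrix.specialUnitaryGroup (Fin 2) ℂ), UkH 0 (Hist.triv (F.P K) 0) V = V)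
      (hUs : ∀ (k : ℕ) (V : GaugeField (F.P K) (k + 1) (Matrix.specialUnitaryGroup (Fin 2) ℂ)),
        UkH (k + 1) (Hist.triv (F.P K) (k + 1)) V = Uk k V)
      (𝔖 : ∀ k, StepSeries (T3Scales F γ hγ (hγ1.trans (sq_min_one_le _ 𝔠.gamma0_pos)) K)
        (Matrix.specialUnitaryGroup (Fin 2) ℂ) ↥(lieC (suGroupModel 2))
        (nblkOf (T3Scales F γ hγ (hγ1.trans (sq_min_one_le _ 𝔠.gamma0_pos)) K) 𝔠.lane.carrier k) k)
      (𝔄 : AlphaDataAC (suGroupModel 2) 𝔠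
        (XT3 F γ hγ (hγ1.trans (sq_min_one_le _ 𝔠.gamma0_pos)) K reg Uk UkH hU0 hUs) 𝔖),
      RunAlphaV3AC (suGroupModel 2) 𝔠 (XT3 F γ hγ (hγ1.trans (sq_min_one_le _ 𝔠.gamma0_pos)) K reg Uk UkH hU0 hUs) 𝔖 𝔄
          (AlphaInputsT3AC.admWindowT3 F 𝔠 γ hγ hγ1 K) ∧
        MinimiserRowsT3 F 𝔠 γ hγ hγ1 a₀ a₁ K UkH ∧
          TerminalRowsT3 F 𝔠 γ hγ hγ1 K (XT3 F γ hγ (hγ1.trans (sq_min_one_le _ 𝔠.gamma0_pos)) K reg Uk UkH hU0 hUs) 𝔖 (𝔄.cP K)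

/-- **`AlphaInputsT3ACv3Rec L` — THE RECORD-PARAMETRIC v3 SOCKET** (owner ruling g18-№3 §3; `AlphaInputsT3ACv2Rec`'s text with `OfV2At ↦ OfV3At`): thresholds `b₁, p₁`
such that for every profile `(b₀, p₀)` beyond them there is a primitive-constants record `𝔠` with EXACTLY that p-function (`𝔠.b₀ = b₀`, `𝔠.p₀ = p₀`) and
[Balaban1985Variational] constants `a₀, a₁` (bound BEFORE the family) such that the v3 package holds at those constants for EVERY three-torus family of block size
`L`.  OPEN, never asserted. [cite: Balaban1985UV3, (7) p.257 and Thm 2 p.272; Balaban1985Variational, Thm 1 (8) p.279] -/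
def AlphaInputsT3ACv3Rec (L : ℕ) : Prop :=
  ∃ (b₁ p₁ : ℝ), ∀ (b₀ p₀ : ℝ), b₁ ≤ b₀ → p₁ ≤ p₀ →
    ∃ (𝔠 : AlphaConsts L (suGroupModel 2).N) (a₀ a₁ : ℝ), 𝔠.b₀ = b₀ ∧ 𝔠.p₀ = p₀ ∧ 0 < a₀ ∧ 0 < a₁ ∧ 𝔠.B₃ * a₁ ≤ a₀ ∧
      ∀ (F : T3Family) (hF : F.L = L), AlphaInputsT3AC.OfV3At F (hF ▸ 𝔠) a₀ a₁

/-! ## §2 The package's data at `(γ, K)` carrying the given constants -/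

section Pkg

variable (F : T3Family) (𝔠 : AlphaConsts F.L (suGroupModel 2).N) (γ : ℝ) (hγ : 0 < γ) (hγ1 : γ ≤ (min 𝔠.gamma0 1) ^ 2) (K : ℕ)

/-- **THE VERSION-3 PACKAGE'S DATA AT `(γ, K)`**: regular classes, minimizers, composite minimizers (`U_0(·,triv) = id`, `U_{k+1}(·,triv) = U_k`), expansion data `𝔖`,
auxiliary data `𝔄`, the v3 (α) rows for them at the (40) windows, the [7] constants with the minimiser rows, the terminal rows — `OfV3At`'s ∃-clause as a record
(`PkgAtV2`'s field list with `run : RunAlphaV3AC …`). [cite: Balaban1985UV3, Thm 2 p.272; Balaban1985Variational, Thm 1 (8) p.279] -/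
structure AlphaInputsT3AC.PkgAtV3 where
  /-- regular classes of [Balaban1985Variational] -/
  reg : ℕ → Set (GaugeField (F.P K) 0 (Matrix.specialUnitaryGroup (Fin 2) ℂ))
  /-- minimizers `U_k(V)` -/
  Uk : (k : ℕ) → GaugeField (F.P K) (k + 1) (Matrix.specialUnitaryGroup (Fin 2) ℂ) →
    GaugeField (F.P K) 0 (Matrix.specialUnitaryGroup (Fin 2) ℂ)
  /-- composite minimizers `U_k(V, h)` of (42) -/
  UkH : (k : ℕ) → Hist (F.P K) k → GaugeField (F.P K) k (Matrix.specialUnitaryGroup (Fin 2) ℂ) →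
    GaugeField (F.P K) 0 (Matrix.specialUnitaryGroup (Fin 2) ℂ)
  /-- `U_0(V, triv) = V` -/
  hU0 : ∀ V : GaugeField (F.P K) 0 (Matrix.specialUnitaryGroup (Fin 2) ℂ), UkH 0 (Hist.triv (F.P K) 0) V = V
  /-- `U_{k+1}(V, triv) = U_k(V)` -/
  hUs : ∀ (k : ℕ) (V : GaugeField (F.P K) (k + 1) (Matrix.specialUnitaryGroup (Fin 2) ℂ)),
    UkH (k + 1) (Hist.triv (F.P K) (k + 1)) V = Uk k V
  /-- expansion data (chart values in `𝔰𝔲(2)ᶜ`) -/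
  𝔖 : ∀ k, StepSeries (T3Scales F γ hγ (hγ1.trans (sq_min_one_le _ 𝔠.gamma0_pos)) K) (Matrix.specialUnitaryGroup (Fin 2) ℂ)
    ↥(lieC (suGroupModel 2)) (nblkOf (T3Scales F γ hγ (hγ1.trans (sq_min_one_le _ 𝔠.gamma0_pos)) K) 𝔠.lane.carrier k) k
  /-- auxiliary (α) data -/
  𝔄 : AlphaDataAC (suGroupModel 2) 𝔠 (XT3 F γ hγ (hγ1.trans (sq_min_one_le _ 𝔠.gamma0_pos)) K reg Uk UkH hU0 hUs) 𝔖
  /-- the v3 (α) rows hold for these data at the (40) windows -/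
  run : RunAlphaV3AC (suGroupModel 2) 𝔠 (XT3 F γ hγ (hγ1.trans (sq_min_one_le _ 𝔠.gamma0_pos)) K reg Uk UkH hU0 hUs) 𝔖 𝔄
    (AlphaInputsT3AC.admWindowT3 F 𝔠 γ hγ hγ1 K)
  /-- the constant `a₀` of [Balaban1985Variational] Thm 1 -/
  a₀ : ℝ
  /-- the constant `a₁` of [Balaban1985Variational] Thm 1 -/
  a₁ : ℝ
  /-- `0 < a₀`, `0 < a₁`, `B₃a₁ ≤ a₀` -/
  consts_ok : 0 < a₀ ∧ 0 < a₁ ∧ 𝔠.B₃ * a₁ ≤ a₀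
  /-- the minimiser rows r1–r3 for `UkH` -/
  minRows : MinimiserRowsT3 F 𝔠 γ hγ hγ1 a₀ a₁ K UkH
  /-- the terminal data-regularity rows at `k = K` -/
  termRows : TerminalRowsT3 F 𝔠 γ hγ hγ1 K (XT3 F γ hγ (hγ1.trans (sq_min_one_le _ 𝔠.gamma0_pos)) K reg Uk UkH hU0 hUs) 𝔖 (𝔄.cP K)

variable {F 𝔠 γ hγ hγ1 K} {a₀ a₁ : ℝ}

/-- At given constants the v3 record exists with `a₀, a₁` EQUAL to the given ones. [cite: Balaban1985UV3, Thm 2 p.272] -/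
theorem AlphaInputsT3AC.OfV3At.nonempty_pkgAtV3 (h : AlphaInputsT3AC.OfV3At F 𝔠 a₀ a₁) (hc : 0 < a₀ ∧ 0 < a₁ ∧ 𝔠.B₃ * a₁ ≤ a₀)
    (γ : ℝ) (hγ : 0 < γ) (hγ1 : γ ≤ (min 𝔠.gamma0 1) ^ 2) (K : ℕ) :
    Nonempty {p : AlphaInputsT3AC.PkgAtV3 F 𝔠 γ hγ hγ1 K // p.a₀ = a₀ ∧ p.a₁ = a₁} := by
  obtain ⟨reg, Uk, UkH, hU0, hUs, 𝔖, 𝔄, hR, hM, hT⟩ := h γ hγ hγ1 K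
  exact ⟨⟨⟨reg, Uk, UkH, hU0, hUs, 𝔖, 𝔄, hR, a₀, a₁, hc, hM, hT⟩, rfl, rfl⟩⟩

/-- **THE v3 RECORD AT GIVEN CONSTANTS, CHOSEN** — its `a₀`, `a₁` ARE the given ones (`pkgAtV3_a₀`/`pkgAtV3_a₁`). [cite: Balaban1985UV3, Thm 2 p.272] -/
noncomputable def AlphaInputsT3AC.OfV3At.pkgAtV3 (h : AlphaInputsT3AC.OfV3At F 𝔠 a₀ a₁) (hc : 0 < a₀ ∧ 0 < a₁ ∧ 𝔠.B₃ * a₁ ≤ a₀)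
    (γ : ℝ) (hγ : 0 < γ) (hγ1 : γ ≤ (min 𝔠.gamma0 1) ^ 2) (K : ℕ) :
    AlphaInputsT3AC.PkgAtV3 F 𝔠 γ hγ hγ1 K :=
  (Classical.choice (h.nonempty_pkgAtV3 hc γ hγ hγ1 K)).1

/-- The chosen record's `a₀` is the given `a₀`. [cite: Balaban1985Variational, Thm 1 (8) p.279] -/
theorem AlphaInputsT3AC.OfV3At.pkgAtV3_a₀ (h : AlphaInputsT3AC.OfV3At F 𝔠 a₀ a₁) (hc : 0 < a₀ ∧ 0 < a₁ ∧ 𝔠.B₃ * a₁ ≤ a₀)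
    (γ : ℝ) (hγ : 0 < γ) (hγ1 : γ ≤ (min 𝔠.gamma0 1) ^ 2) (K : ℕ) :
    (h.pkgAtV3 hc γ hγ hγ1 K).a₀ = a₀ :=
  (Classical.choice (h.nonempty_pkgAtV3 hc γ hγ hγ1 K)).2.1

/-- The chosen record's `a₁` is the given `a₁`. [cite: Balaban1985Variational, Thm 1 (7)-(8) p.279] -/
theorem AlphaInputsT3AC.OfV3At.pkgAtV3_a₁ (h : AlphaInputsT3AC.OfV3At F 𝔠 a₀ a₁) (hc : 0 < a₀ ∧ 0 < a₁ ∧ 𝔠.B₃ * a₁ ≤ a₀)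
    (γ : ℝ) (hγ : 0 < γ) (hγ1 : γ ≤ (min 𝔠.gamma0 1) ^ 2) (K : ℕ) :
    (h.pkgAtV3 hc γ hγ hγ1 K).a₁ = a₁ :=
  (Classical.choice (h.nonempty_pkgAtV3 hc γ hγ hγ1 K)).2.2

end Pkg

/-! ## §3 The record's API -/

section Api

variable {F : T3Family} {𝔠 : AlphaConsts F.L (suGroupModel 2).N} {γ : ℝ} {hγ : 0 < γ} {hγ1 : γ ≤ (min 𝔠.gamma0 1) ^ 2} {K : ℕ}

namespace AlphaInputsT3AC.PkgAtV3

variable (p : AlphaInputsT3AC.PkgAtV3 F 𝔠 γ hγ hγ1 K)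

/-- The AC external inputs of the package's data (averaging `blockAvg ℰp`). [cite: Balaban1985UV3, (2) p.256] -/
abbrev X : ExternalInputsAC (T3Scales F γ hγ (hγ1.trans (sq_min_one_le _ 𝔠.gamma0_pos)) K) (Matrix.specialUnitaryGroup (Fin 2) ℂ) :=
  XT3 F γ hγ (hγ1.trans (sq_min_one_le _ 𝔠.gamma0_pos)) K p.reg p.Uk p.UkH p.hU0 p.hUs

/-- The lane's AC tower of the package's data, as a `B10.TowerRun`. [cite: Balaban1985UV3, (38)–(43) p.266] -/
abbrev T : B10.TowerRun := towerOfAC 𝔠.lane p.X p.𝔖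

/-- The tower's start constant `E = E_0 = Σ_{i<K} E^{(i)}` ((62)/(64)). [cite: Balaban1985UV3, (62) p.271] -/
abbrev E : ℝ := B10.Ek (inputOfAC 𝔠.lane p.X p.𝔖).Estep K 0

/-- The windowed pinned weights of the record: `PinnedStep.wtP` at the record's inputs with the (40) windows. [cite: Balaban1985UV3, (40)–(41) p.266] -/
abbrev wtP (j : ℕ) (r : Hist (F.P K) j) : GaugeField (F.P K) j (Matrix.specialUnitaryGroup (Fin 2) ℂ) → ℝ :=
  PinnedStep.wtP 𝔠.lane p.X (AlphaInputsT3AC.admWindowT3 F 𝔠 γ hγ hγ1 K) j r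

/-- **(47) FOR THE PACKAGE'S TOWER**, every `k ≤ K`, pointwise (`AlphaV3AC.ineq47_of_alphaV3` on the window `T3Scales_window`). [cite: Balaban1985UV3, (47) p.267 + Thm 2 p.272] -/
theorem ineq47 (k : ℕ) (hk : k ≤ K) : Ineq47 p.T k :=
  ineq47_of_alphaV3 (T3Scales_window F 𝔠 γ hγ hγ1 K) p.run k hk

/-- **THE v3 ROWS AT THE (40) WINDOWS, BY PROJECTION**: `PinnedStep.Fibre55WinAC` at every step `k < K` and every new history. [cite: Balaban1985UV3, (55) p.269 + (58) p.270] -/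
theorem fibre55Win (k : ℕ) (hk : k + 1 ≤ K) (h' : Hist (F.P K) (k + 1)) :
    PinnedStep.Fibre55WinAC 𝔠.lane p.X p.𝔖 (AlphaInputsT3AC.admWindowT3 F 𝔠 γ hγ hγ1 K) k h' :=
  (p.run.steps k hk).fibre55Win h'

/-- **THE (41)_{k+1} EXPONENT STEP FOR THE PACKAGE'S TOWER**, every `k < K`, every new history (`AlphaV3AC.expo5558_le_expo41_succ_of_alphaV3`).
[cite: Balaban1985UV3, (41) p.266 + (58)–(62) pp.270–271] -/
theorem expo_succ (k : ℕ) (hk : k + 1 ≤ K) (hh : Hist (F.P K) (k + 1)) (U : GaugeField (F.P K) (k + 1) (Matrix.specialUnitaryGroup (Fin 2) ℂ)) :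
    -(p.T.mainT (k + 1) hh U) - p.T.Ecst k
        + ((piecesAC 𝔠.lane p.X p.𝔖 k).logσ₀ + (piecesAC 𝔠.lane p.X p.𝔖 k).dg * Real.log (p.T.g k)) * (piecesAC 𝔠.lane p.X p.𝔖 k).starB hh
        + (piecesAC 𝔠.lane p.X p.𝔖 k).logZU hh U + (piecesAC 𝔠.lane p.X p.𝔖 k).Pold hh U
        + p.T.Zterm k ((piecesAC 𝔠.lane p.X p.𝔖 k).proj hh) + p.T.Rm k + (piecesAC 𝔠.lane p.X p.𝔖 k).logFl hh U ≤
      -(p.T.mainT (k + 1) hh U) + p.T.Pint (k + 1) hh U - p.T.Ecst (k + 1) + p.T.Zterm (k + 1) hh + p.T.Rm (k + 1) :=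
  expo5558_le_expo41_succ_of_alphaV3 (T3Scales_window F 𝔠 γ hγ hγ1 K) p.run k hk hh U

/-- Data row, every `k ≤ K`: `U_k(·, h)` is measurable (steps below the top, terminal row at the top). [cite: Balaban1985UV3, (42) p.266] -/
theorem measurable_UkH (k : ℕ) (hk : k ≤ K) (h : Hist (F.P K) k) : Measurable (p.UkH k h) := by
  rcases Nat.lt_or_eq_of_le hk with hlt | rfl
  · exact (p.run.steps k hlt).hU h
  · exact p.termRows.1 h

/-- Data row, every `k ≤ K`: `Pint_k(h, ·)` is measurable. [cite: Balaban1985UV3, (43) p.266] -/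
theorem measurable_Pint (k : ℕ) (hk : k ≤ K) (h : Hist (F.P K) k) : Measurable ((inputOfAC 𝔠.lane p.X p.𝔖).Pint k h) := by
  rcases Nat.lt_or_eq_of_le hk with hlt | rfl
  · exact (p.run.steps k hlt).hPm h
  · exact p.termRows.2.1 h

/-- Data row, every `k ≤ K`: `Pint_k(h, U) ≤ cP_k`. [cite: Balaban1985UV3, (46) p.267] -/
theorem Pint_le (k : ℕ) (hk : k ≤ K) (h : Hist (F.P K) k) (U : GaugeField (F.P K) k (Matrix.specialUnitaryGroup (Fin 2) ℂ)) :
    (inputOfAC 𝔠.lane p.X p.𝔖).Pint k h U ≤ p.𝔄.cP k := by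
  rcases Nat.lt_or_eq_of_le hk with hlt | rfl
  · exact (p.run.steps k hlt).hPb h U
  · exact p.termRows.2.2 h U

/-- The tower's density IS `dV`-a.e. the cell's RN tower from `e^{−E}·e^{−β_K A}` (`rho_towerOfAC_ae_eq_towerDensity`). [cite: Balaban1985UV3, (2) p.256] -/
theorem rho_ae_eq (q : AlphaInputsT3AC.PkgAtV3 F 𝔠 γ hγ hγ1 K) (k : ℕ) (hk : k ≤ F.m + K) :
    q.T.ρ k =ᵐ[fieldMeasure (F.P K) k (Matrix.specialUnitaryGroup (Fin 2) ℂ)]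
      towerDensity F K (fun U => Real.exp (-q.E) * boltzmann (F.P K) ((F.scheme ℰp γ).β K) U) k :=
  rho_towerOfAC_ae_eq_towerDensity 𝔠.lane q.X rfl q.𝔖 k hk

/-- **THE ROUTE'S RESTRICTED DENSITY IS `e^{E}` TIMES THE TOWER'S, `dV`-a.e.**: `resDensity F γ K univ j = e^{E}·ρ_j` a.e., `j ≤ m + K` (`PkgAt.resDensity_ae_eq`'s proof).
[cite: Balaban1985UV3, (1)–(2) p.256] -/
theorem resDensity_ae_eq (q : AlphaInputsT3AC.PkgAtV3 F 𝔠 γ hγ hγ1 K) (k : ℕ) (hk : k ≤ F.m + K) :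
    resDensity F γ K Set.univ k =ᵐ[fieldMeasure (F.P K) k (Matrix.specialUnitaryGroup (Fin 2) ℂ)] fun V => Real.exp q.E * q.T.ρ k V := by
  have hρ₀ : ∀ U, 0 ≤ Real.exp (-q.E) * boltzmann (F.P K) ((F.scheme ℰp γ).β K) U := fun U =>
    mul_nonneg (Real.exp_nonneg _) (Missing.boltzmann_pos (G := Matrix.specialUnitaryGroup (Fin 2) ℂ) (F.P K) _ U).le
  have hint : Integrable (fun U => Real.exp (-q.E) * boltzmann (F.P K) ((F.scheme ℰp γ).β K) U)
      (fieldMeasure (F.P K) 0 (Matrix.specialUnitaryGroup (Fin 2) ℂ)) := by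
    have h := integrable_wilsonStart (P := (T3Scales F γ hγ (hγ1.trans (sq_min_one_le _ 𝔠.gamma0_pos)) K).P)
      (G := Matrix.specialUnitaryGroup (Fin 2) ℂ) (g0sq_nonneg (T3Scales F γ hγ (hγ1.trans (sq_min_one_le _ 𝔠.gamma0_pos)) K)) q.E
    rw [wilsonStart_T3_eq] at h
    exact h
  have hstart : Set.univ.indicator (boltzmann (G := Matrix.specialUnitaryGroup (Fin 2) ℂ) (F.P K) ((F.scheme ℰp γ).β K)) =
      fun U => Real.exp q.E * (Real.exp (-q.E) * boltzmann (F.P K) ((F.scheme ℰp γ).β K) U) := by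
    funext U
    rw [Set.indicator_univ, ← mul_assoc, ← Real.exp_add, add_neg_cancel, Real.exp_zero, one_mul]
  have h1 := towerDensity_const_mul_ae F K _ hρ₀ hint (Real.exp_nonneg q.E) k hk
  have h2 := q.rho_ae_eq k hk
  show towerDensity F K (Set.univ.indicator (boltzmann (F.P K) ((F.scheme ℰp γ).β K))) k =ᵐ[_] _
  rw [hstart]
  filter_upwards [h1, h2] with V hV1 hV2
  rw [hV1, hV2]

/-- **(47)′ FOR THE ROUTE'S DENSITY, `dV`-a.e., CONSTANTS PULLED OUT**: for `j ≤ K`, almost every `W`,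
`exp(−(E_j − E) − Rm_j)·χ_j(W)·exp(−mainT_j(triv,W) + Pint_j(triv,W)) ≤ resDensity F γ K univ j W` (`PkgAt.le_resDensity_ae`'s proof). [cite: Balaban1985UV3, (47) p.267 + Thm 2 p.272] -/
theorem le_resDensity_ae (q : AlphaInputsT3AC.PkgAtV3 F 𝔠 γ hγ hγ1 K) (j : ℕ) (hj : j ≤ K) :
    ∀ᵐ W ∂fieldMeasure (F.P K) j (Matrix.specialUnitaryGroup (Fin 2) ℂ),
      Real.exp (-(q.T.Ecst j - q.E) - q.T.Rm j) *
          (q.T.χ j W * Real.exp (-(q.T.mainT j (q.T.triv j) W) + q.T.Pint j (q.T.triv j) W)) ≤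
        resDensity F γ K Set.univ j W := by
  have h47 := q.ineq47 j hj
  filter_upwards [q.resDensity_ae_eq j (by omega)] with W hW
  rw [hW]
  have hb := h47 W
  have hsplit : q.T.χ j W * Real.exp (-(q.T.mainT j (q.T.triv j) W) + q.T.Pint j (q.T.triv j) W - q.T.Ecst j - q.T.Rm j) =
      Real.exp (-(q.T.Ecst j) - q.T.Rm j) *
        (q.T.χ j W * Real.exp (-(q.T.mainT j (q.T.triv j) W) + q.T.Pint j (q.T.triv j) W)) := by
    rw [mul_left_comm, ← Real.exp_add]; congr 2; ring
  rw [hsplit] at hb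
  have hE : Real.exp (-(q.T.Ecst j - q.E) - q.T.Rm j) = Real.exp q.E * Real.exp (-(q.T.Ecst j) - q.T.Rm j) := by
    rw [← Real.exp_add]; congr 1; ring
  rw [hE, mul_assoc]
  exact mul_le_mul_of_nonneg_left hb (Real.exp_nonneg _)

/-- `mainT_j(h, W) = β_K · A₄(U_j(h, W))` (`mainT_towerOfAC_T3_eq`). [cite: Balaban1985UV3, (5) p.256 + (41) p.266] -/
theorem mainT_eq (j : ℕ) (h : Hist (F.P K) j) (W : GaugeField (F.P K) j (Matrix.specialUnitaryGroup (Fin 2) ℂ)) :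
    p.T.mainT j h W = (F.scheme ℰp γ).β K * wilsonAction4 (p.UkH j h W) :=
  mainT_towerOfAC_T3_eq 𝔠.lane p.X p.𝔖 j h W

/-- `E_j − E = −Σ_{i<j} E^{(i)}` for `j ≤ K` ((64) and `E = E_0`). [cite: Balaban1985UV3, (62) p.271 + (64) p.272] -/
theorem Ecst_sub_E_eq (j : ℕ) (hj : j ≤ K) : p.T.Ecst j - p.E = -∑ i ∈ Finset.range j, p.T.Estep i := by
  have h1 : p.T.Ecst j = ∑ i ∈ Finset.Ico j K, p.T.Estep i := p.T.Ecst_eq j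
  have h2 : p.E = ∑ i ∈ Finset.Ico 0 K, p.T.Estep i := rfl
  rw [h1, h2, Finset.range_eq_Ico, ← Finset.sum_Ico_consecutive _ (Nat.zero_le j) hj]
  ring

/-- **THE REMAINDER, CLOSED FORM**: `Rm_j = r⋆·γ^{3+κ₀}·(Σ_{i<j} q^{K−i})·(2L^m)³`, `q = L^{−κ₀}` for `j ≤ K` (`PkgAt.Rm_eq`'s proof). [cite: Balaban1985UV3, (41) p.266] -/
theorem Rm_eq (j : ℕ) (hj : j ≤ K) :
    p.T.Rm j = 𝔠.stepConsts.rstar * γ ^ (3 + 𝔠.κ₀) *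
      (∑ i ∈ Finset.range j, (((F.L : ℝ)⁻¹) ^ 𝔠.κ₀) ^ (K - i)) * (2 * (F.L : ℝ) ^ F.m) ^ 3 := by
  have hg2 : (T3Scales F γ hγ (hγ1.trans (sq_min_one_le _ 𝔠.gamma0_pos)) K).g ^ 2 = γ := Real.sq_sqrt hγ.le
  show ∑ i ∈ Finset.range j, rcoefOf _ 𝔠.lane.carrier i *
      ((F.L : ℝ) ^ i * (T3Scales F γ hγ (hγ1.trans (sq_min_one_le _ 𝔠.gamma0_pos)) K).ε) ^ (3 + 𝔠.κ₀) *
        (T3Scales F γ hγ (hγ1.trans (sq_min_one_le _ 𝔠.gamma0_pos)) K).sites i = _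
  rw [Finset.mul_sum, Finset.sum_mul]
  refine Finset.sum_congr rfl fun i hi => ?_
  have hiK : i ≤ K := (Finset.mem_range.mp hi).le.trans hj
  rw [rcoefOf_carrier, hg2, mul_assoc,
    rem_unit_T3Scales F γ hγ (hγ1.trans (sq_min_one_le _ 𝔠.gamma0_pos)) K 𝔠.κ₀ i hiK]
  show 𝔠.stepConsts.rstar * γ ^ (3 + 𝔠.κ₀) * ((((F.L : ℝ)⁻¹) ^ 𝔠.κ₀) ^ (K - i) * (2 * (F.L : ℝ) ^ F.m) ^ 3) = _
  ring

/-- `ε₁(j) = g_j p(g_j) = θBal F.L γ b₀ p₀ (K − j)` for `j ≤ K` (`PkgAt.eps1_eq`'s proof). [cite: Balaban1985UV3, (7) p.257] -/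
theorem eps1_eq (j : ℕ) (hj : j ≤ K) : (inputOfAC 𝔠.lane p.X p.𝔖).ε₁ j = θBal F.L γ 𝔠.b₀ 𝔠.p₀ (K - j) := by
  show (T3Scales F γ hγ (hγ1.trans (sq_min_one_le _ 𝔠.gamma0_pos)) K).gk j *
      B10.pFun 𝔠.b₀ 𝔠.p₀ ((T3Scales F γ hγ (hγ1.trans (sq_min_one_le _ 𝔠.gamma0_pos)) K).gk j) = _
  rw [T3Scales_gk_eq F γ hγ _ K j hj]
  rfl

include p in
/-- `0 < θBal(K − j)` for `j ≤ K` (`= ε₁(j) > 0`). [cite: Balaban1985UV3, (7) p.257] -/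
theorem θBal_pos (j : ℕ) (hj : j ≤ K) : 0 < θBal F.L γ 𝔠.b₀ 𝔠.p₀ (K - j) := by
  rw [← p.eps1_eq j hj]
  exact eps1_inputOfAC_pos 𝔠.lane p.X p.𝔖 j hj

/-- r2 projected: (42)/(67) at the top level for a charged pair. [cite: Balaban1985UV3, (42) p.266 and (67) p.273] -/
theorem constraint42 (k : ℕ) (hk : k ≤ K) (h : Hist (F.P K) k) (W : GaugeField (F.P K) k (Matrix.specialUnitaryGroup (Fin 2) ℂ))
    (hc : ChargedT3 F γ 𝔠.b₀ 𝔠.p₀ (avgWindowFactor F.L) K 𝔠.lane.carrier.M₁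
      (rcolOf (T3Scales F γ hγ (hγ1.trans (sq_min_one_le _ 𝔠.gamma0_pos)) K) 𝔠.lane.carrier) k h W)
    (b : PBond (F.P K) k)
    (hb : b ∈ bondsIn k (Omega 𝔠.lane.carrier.M₁
      (rcolOf (T3Scales F γ hγ (hγ1.trans (sq_min_one_le _ 𝔠.gamma0_pos)) K) 𝔠.lane.carrier) k h k)) :
    Averaging.iter (fun i => BlockAveraging.blockAvg (P := F.P K) (j := i) ℰp) k (p.UkH k h W) b = W b :=
  p.minRows.2.1 k hk h W hc b hb

/-- r3 projected: (68) in the multi-level form for a charged pair. [cite: Balaban1985UV3, (68) p.273] -/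
theorem regularity68Levels (k : ℕ) (hk : k ≤ K) (h : Hist (F.P K) k) (W : GaugeField (F.P K) k (Matrix.specialUnitaryGroup (Fin 2) ℂ))
    (hc : ChargedT3 F γ 𝔠.b₀ 𝔠.p₀ (avgWindowFactor F.L) K 𝔠.lane.carrier.M₁
      (rcolOf (T3Scales F γ hγ (hγ1.trans (sq_min_one_le _ 𝔠.gamma0_pos)) K) 𝔠.lane.carrier) k h W)
    (i : ℕ) (hi : i ≤ k) (s : ℕ) (hs : s ≤ i) (q : Plaq (F.P K) s)
    (hq : q ∈ plaqsIn s (lam42 (Omega 𝔠.lane.carrier.M₁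
      (rcolOf (T3Scales F γ hγ (hγ1.trans (sq_min_one_le _ 𝔠.gamma0_pos)) K) 𝔠.lane.carrier) k h) k i)) :
    GaugeGroup.dist1 (GaugeField.plaqHol
        (Averaging.iter (fun l => BlockAveraging.blockAvg (P := F.P K) (j := l) ℰp) s (p.UkH k h W)) q) ≤
      𝔠.C68 * θBal F.L γ 𝔠.b₀ 𝔠.p₀ (K - i) * (((F.L : ℝ) ^ (i - s))⁻¹) ^ 2 :=
  p.minRows.2.2 k hk h W hc i hi s hs q hq

/-- r1 projected, membership: `U_{K−n}(triv, V) ∈ regFibrePr F n K _ ε₀ V` under the [7] bookkeeping. [cite: Balaban1985Variational, Thm 1 (8) p.279] -/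
theorem uminTriv_mem_regFibrePr (q : AlphaInputsT3AC.PkgAtV3 F 𝔠 γ hγ hγ1 K) {n : ℕ} (hnK : n < K) {ε₁ ε₀ : ℝ} (hε₁ : 0 < ε₁) (ha₁ : ε₁ ≤ q.a₁)
    (hlo : 𝔠.B₃ * ε₁ ≤ ε₀) (hhi : ε₀ ≤ q.a₀) (V : GaugeField (F.P n) 0 (Matrix.specialUnitaryGroup (Fin 2) ℂ)) (hV : PlaqSmall ε₁ V) :
    q.UkH (K - n) (Hist.triv (F.P K) (K - n))
        (fieldShift (F.sitesPerDir_eq (m := F.m) (K := K) (j := K - n) (m' := F.m) (K' := n) (j' := 0) (by omega)) V) ∈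
      regFibrePr F n K hnK.le ε₀ V :=
  regFibrePr_mono F hlo V (q.minRows.1 n hnK ε₁ ε₀ hε₁ ha₁ hlo hhi V hV).1

/-- r1 projected, value: the Wilson action of `U_{K−n}(triv, V)` IS `minActionRegPr F n K _ ε₀ V`. [cite: Balaban1985Variational, Thm 1 (8) p.279 and Prop 7 p.299] -/
theorem uminTriv_action_eq (q : AlphaInputsT3AC.PkgAtV3 F 𝔠 γ hγ hγ1 K) {n : ℕ} (hnK : n < K) {ε₁ ε₀ : ℝ} (hε₁ : 0 < ε₁) (ha₁ : ε₁ ≤ q.a₁)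
    (hlo : 𝔠.B₃ * ε₁ ≤ ε₀) (hhi : ε₀ ≤ q.a₀) (V : GaugeField (F.P n) 0 (Matrix.specialUnitaryGroup (Fin 2) ℂ)) (hV : PlaqSmall ε₁ V) :
    wilsonAction4 (q.UkH (K - n) (Hist.triv (F.P K) (K - n))
        (fieldShift (F.sitesPerDir_eq (m := F.m) (K := K) (j := K - n) (m' := F.m) (K' := n) (j' := 0) (by omega)) V)) =
      minActionRegPr F n K hnK.le ε₀ V :=
  minActionRegPr_eq_of_isMinOn F (q.uminTriv_mem_regFibrePr hnK hε₁ ha₁ hlo hhi V hV) (q.minRows.1 n hnK ε₁ ε₀ hε₁ ha₁ hlo hhi V hV).2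

/-! ## §4 (41) with the windowed pinned weights, `dV`-a.e., from the v3 rows alone -/

/-- **(41) FOR THE PACKAGE'S TOWER WITH PRINT'S WINDOWED PINNED WEIGHTS, `dV`-a.e., EVERY `j ≤ K`, FROM THE v3 ROWS ALONE**:
`ρ_j(V) ≤ Σ_h wtP_j(h, V)·exp(−mainT_j(h,V) + Pint_j(h,V) − E_j + Zterm_j(h) + Rm_j)` a.e. — `PinnedStep.ineq41_pinned_windowed_ae_of_expo` fed by the projected rows
`fibre55Win`, the exponent step `expo_succ` (eight mass-free leaves), the data rows, and the measurability of the (40) windows.  No floored masses, no transported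
trivial mass, no Haar compatibility. [cite: Balaban1985UV3, (41) p.266 + (55) p.269 + Thm 2 p.272] -/
theorem ineq41P_ae (j : ℕ) (hj : j ≤ K) :
    ∀ᵐ V ∂fieldMeasure (F.P K) j (Matrix.specialUnitaryGroup (Fin 2) ℂ), p.T.ρ j V ≤
      ∑ h : Hist (F.P K) j, p.wtP j h V * Real.exp (-(p.T.mainT j h V) + p.T.Pint j h V - p.T.Ecst j + p.T.Zterm j h + p.T.Rm j) :=
  PinnedStep.ineq41_pinned_windowed_ae_of_expo 𝔠.lane p.X p.𝔖 (AlphaInputsT3AC.admWindowT3 F 𝔠 γ hγ hγ1 K)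
    (AlphaInputsT3AC.measurableSet_admWindowT3 F 𝔠 γ hγ hγ1 K) p.fibre55Win p.expo_succ (fun k hk => (p.run.steps k hk).hU)
    (fun k hk => (p.run.steps k hk).hPm) (fun k hk => ⟨p.𝔄.cP k, (p.run.steps k hk).hPb⟩) j hj

/-- **(41)′ WITH THE WINDOWED PINNED WEIGHTS FOR THE ROUTE'S DENSITY, `dV`-a.e., CONSTANTS PULLED OUT**: for `j ≤ K`, almost every `W`,
`resDensity F γ K univ j W ≤ exp(−(E_j − E) + Rm_j)·Σ_h wtP_j(h, W)·exp(−mainT_j(h,W) + Pint_j(h,W) + Zterm_j(h))` (`ineq41P_ae` and `resDensity = e^{E}ρ_j` a.e.).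
[cite: Balaban1985UV3, (41) p.266 + Thm 2 p.272] -/
theorem resDensity_le_sum_ae (j : ℕ) (hj : j ≤ K) :
    ∀ᵐ W ∂fieldMeasure (F.P K) j (Matrix.specialUnitaryGroup (Fin 2) ℂ),
      resDensity F γ K Set.univ j W ≤ Real.exp (-(p.T.Ecst j - p.E) + p.T.Rm j) *
        ∑ h : Hist (F.P K) j, p.wtP j h W * Real.exp (-(p.T.mainT j h W) + p.T.Pint j h W + p.T.Zterm j h) := by
  have hE : Real.exp (-(p.T.Ecst j - p.E) + p.T.Rm j) = Real.exp p.E * Real.exp (-(p.T.Ecst j) + p.T.Rm j) := by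
    rw [← Real.exp_add]; congr 1; ring
  have hsplit : ∀ (a b c d r : ℝ), Real.exp (-a + b - c + d + r) = Real.exp (-c + r) * Real.exp (-a + b + d) := fun a b c d r => by
    rw [← Real.exp_add]; congr 1; ring
  filter_upwards [p.ineq41P_ae j hj, p.resDensity_ae_eq j (by omega)] with W hW hR
  rw [hR, hE, mul_assoc]
  refine mul_le_mul_of_nonneg_left ?_ (Real.exp_pos _).le
  simp only [hsplit] at hW
  refine hW.trans (le_of_eq ?_)
  rw [Finset.mul_sum]
  exact Finset.sum_congr rfl fun r _ => by rw [mul_left_comm]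

end AlphaInputsT3AC.PkgAtV3

end Api

end Summit.QuantumFields.YangMills.Theorems

end
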